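import Summits.QuantumFields.BalabanUV.T4Continuum.Spine.NE3.CurvedLandauGaugeLetters
import HarnessLib

/-!
# T⁴ programme, node NE3 — [B8] AT A CURVED BACKGROUND, brick E′, letter 2b′: ONE GAUGE STEP `V ↦ V^{e^λ}` RELATIVE TO A UNITARY BACKGROUND `W` —
# the COVARIANT divergence of the new relative potential is `covDiv_W (log W⁻¹V) + Δ_W λ` up to a junk term
# `≤ 4Λ(‖covDiv_W log W⁻¹V‖ + ‖Δ_W λ‖) + 25·d·r·γ + 14·d·γ²`, `γ ≥ ‖D_W λ‖_∞` (`CurvedLandauGaugeStep`)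

Cell `pub-balaban`, rung (B)+1 sub-cell t4, row NE3 (OWNER lineage `b2b-balaban-t4-ne3-p1`, generation 27; technique of record: implicit-function ∕
contraction mapping).  The CURVED twin of letter 2b `Spine/NE3/FlatLandauGaugeStep` of the chain «BRICK E OF REP♭ AT FLAT PAIRS»: the same one-step
identity-with-remainder at an ARBITRARY unitary background `W` (no smallness of `W` is used), i.e. the linearisation of the Landau map of
[Balaban1985RegularSpaces] («B8») Sect. E (1.94)–(1.100) at `U₀ = W` — the step towards Prop. 5 ∕ Thm 2's gauge-existence AT THE MINIMISER PAIR
(`PairLandauB8.PairLandauGaugeB8`, census `pub-balaban-gaps/ne/NE3.md` R4), where the background is `W = cavg L U_B`, not `1`.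

THE STEP.  `W` unitary; `V` unitary with relative variables `R(b) := W(b)⁻¹V(b)`, `‖R(b) − 1‖ ≤ r ≤ 1∕20`, relative potential `Z := log R` (so
`V = vary W Z 1 = W·e^{Z}`); a skew site field `λ` with `‖λ‖ ≤ Λ ≤ 1∕10` and COVARIANT oscillation `‖D_W λ‖ ≤ γ ≤ 1∕25`
(`D_W λ (y, μ) = gaugeDir W λ y μ = Ad_{W(y,μ)⁻¹} λ(y) − λ(y + e_μ)`); the gauge transformation `w = e^{λ}`; `V′ := V^{w}`, `Z′ := log W⁻¹V′`.  Then at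
every site `x`:  `‖covDiv_W Z′(x) − covDiv_W Z(x) − Δ_W λ(x)‖ ≤ 4Λ·(‖covDiv_W Z(x)‖ + ‖Δ_W λ(x)‖) + 25·d·r·γ + 14·d·γ²`
(`covDiv_W` = `NE3CovariantWeitzenbock.covDiv W`, `Δ_W` = `PairLandauB8.covLapSite W` = `covDiv_W ∘ D_W`).  MECHANISM: on the bond `(x, μ)`,
`W⁻¹V′ = w̃·R·w′⁻¹` with the TRANSPORTED gauge `w̃ := W⁻¹w(x)W = e^{Ad_{W⁻¹}λ(x)}` and `w′ := w(x + e_μ)` — literally the flat bond of letter 2a with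
`(u, u′) := (w̃, w′)`, `‖w̃ − w′‖ ≤ (5∕4)‖D_Wλ(x,μ)‖`; the pure-gauge part is the abstract star lemma of §1 over the `2d` COVARIANT neighbours
`Ad_{W(x,μ)}λ(x+e_μ)`, `Ad_{W(x−e_μ,μ)⁻¹}λ(x−e_μ)` of `λ(x)`, whose increments sum to `Δ_Wλ(x)` EXACTLY.

WHAT ([folklore]; `d` any, `n : Type*` nonempty finite; 0 def, 0 sorry; letters in 2a′ `Spine/NE3/CurvedLandauGaugeLetters`):
* **`norm_covDiv_mlog_gaugeAct_sub_le_W`** — the displayed junk bound; `gaugeAct_letters_W` — new relative radius `r + (5∕4)γ`, `‖log W⁻¹V^{w}‖ ≤ 2(…)`,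
  skewness, unitarity.

HONEST FRAMING (page 1): elementary lattice ∕ Banach-algebra analysis of OUR objects; `W` is an arbitrary unitary background; nothing of Bałaban's is used,
asserted or discharged; the curved brick E′ (the exact (1.38)-Landau representative relative to `W` with sup member) is NOT landed by this file (it needs
the curved Newton step + scheme + limit over the curved letters (H0_W) `SupRegularityCurvedUniform.supRegularity_uniform` and (HR_W)
`LandauProjectionSupCurvedUniform.covLapSite_sup_le_curved_uniform`, both PROVED, level-free); `PairLandauGaugeB8` ∕ NE3 ∕ NE7 NOT proved; spine PROVED
0∕9; finite T⁴ rung (B)+1 — NOT infinite volume, NOT mass gap, NOT `BetaPertH`, NOT Clay.  Continuum YM on T⁴ ⇐ BetaPertH ∧ nine spine estimates (0/9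
proved); BetaPertH ⇐ (D1) ∧ (D4) ∧ CAP+tail; G-an2-4 gates asym, D1 and NE2/3/4.  PLACEMENT: our lemma, `Spine/NE3/`; imports letter 2a′ `CurvedLandauGaugeLetters` (hence 2a, 1).
-/

set_option autoImplicit false

open NormedSpace
open scoped BigOperators Matrix.Norms.L2Operator
open Finset

namespace Summit.QuantumFields.BalabanUV.T4Continuum.NE3.CurvedLandauGaugeStep

open Literature.MathematicalPhysics.QuantumFieldTheory.Balaban1983to89
open B7Prop1Explicit B7Prop2Explicit MatrixLog
open T4AveragingDeficitWall (Ad IsUnitaryCfg IsSkewDir)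
open T4AveragingDeficitWallBoundary (IsPeriodicCfg periodBox)
open AveragingDeficitPeriodicCounting (IsPeriodicDir)
open AveragingDeficitNearIdentity (norm_Ad_sub_le)
open AveragingDeficitTransport (norm_Ad_of_unitary mem_U1_of_unitary)
open NE3EnergyShapes (IsUnitarySite IsPeriodicSite)
open NE3CovariantWeitzenbock (covDiv)
open NE3.PairLandauB8 (covLapSite)
open NE3.LandauProjectionB8 (covDiv_gaugeDir_eq_covLapSite)
open BlockAveragePushDirGauge (gaugeDir)
open NE7ExpLogSecondOrder (norm_expTail_sub_expTail_le real_exp_sub_one_le_two_mul)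
open NE3.FlatLandauExpStar (norm_starSum_exp_le)
open NE3.FlatLandauGaugeBond

noncomputable section

variable {d : ℕ} {n : Type*} [Fintype n] [DecidableEq n]

open NE3.CurvedLandauGaugeLetters

/-! ## §3 The covariant divergence of the new relative potential -/

section Divergence

variable [Nonempty n]

/-- **ONE GAUGE STEP RELATIVE TO A UNITARY BACKGROUND — THE COVARIANT DIVERGENCE OF THE NEW RELATIVE POTENTIAL.**  `W`, `V` unitary with relative
variables `‖W(b)⁻¹V(b) − 1‖ ≤ r ≤ 1∕20`; a skew site field `λ` with `‖λ‖ ≤ Λ ≤ 1∕10` and covariant oscillation `‖D_Wλ‖ ≤ γ ≤ 1∕25`; `w = e^{λ}`.  With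
`Z := log W⁻¹V`, `Z′ := log W⁻¹V^{w}` (bondwise): `‖covDiv_W Z′(x) − covDiv_W Z(x) − Δ_Wλ(x)‖ ≤ 4Λ(‖covDiv_W Z(x)‖ + ‖Δ_Wλ(x)‖) + 25·d·r·γ + 14·d·γ²`
at every site `x`.  [Balaban1985RegularSpaces] Sect. E (1.94)–(1.100) TYPE at the background `U₀ = W`; an elementary lattice identity-with-remainder,
every junk term vanishing at `λ = 0`. [folklore] -/
theorem norm_covDiv_mlog_gaugeAct_sub_le_W {W V : Site d → Fin d → (Matrix n n ℂ)ˣ} (hWu : IsUnitaryCfg W) (hV : IsUnitaryCfg V) {r : ℝ}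
    (hr : ∀ (y : Site d) (μ : Fin d), ‖(((W y μ)⁻¹ * V y μ : (Matrix n n ℂ)ˣ) : Matrix n n ℂ) - 1‖ ≤ r) (hr1 : r ≤ 1 / 20)
    {lam : Site d → Matrix n n ℂ} (hlams : ∀ y, lam y ∈ skewAdjoint (Matrix n n ℂ)) {Λ γ : ℝ}
    (hΛ : ∀ y, ‖lam y‖ ≤ Λ) (hΛ1 : Λ ≤ 1 / 10) (hγ : ∀ (y : Site d) (μ : Fin d), ‖gaugeDir W lam y μ‖ ≤ γ) (hγ1 : γ ≤ 1 / 25)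
    {w : Site d → (Matrix n n ℂ)ˣ} (hw : ∀ y, (w y : Matrix n n ℂ) = exp (lam y)) (x : Site d) :
    ‖covDiv W (fun y μ => mlog (((W y μ)⁻¹ * gaugeAct w V y μ : (Matrix n n ℂ)ˣ) : Matrix n n ℂ)) x
        - covDiv W (fun y μ => mlog (((W y μ)⁻¹ * V y μ : (Matrix n n ℂ)ˣ) : Matrix n n ℂ)) x - covLapSite W lam x‖
      ≤ 4 * Λ * (‖covDiv W (fun y μ => mlog (((W y μ)⁻¹ * V y μ : (Matrix n n ℂ)ˣ) : Matrix n n ℂ)) x‖ + ‖covLapSite W lam x‖)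
        + 25 * d * r * γ + 14 * d * γ ^ 2 := by
  letI : NormedAlgebra ℚ (Matrix n n ℂ) := NormedAlgebra.restrictScalars ℚ ℝ (Matrix n n ℂ)
  rcases Nat.eq_zero_or_pos d with hd | hd
  · subst hd
    simp [covDiv, covLapSite_eq_sum_neighbours]
  have hΛ0 : 0 ≤ Λ := (norm_nonneg _).trans (hΛ x)
  have hγ0 : 0 ≤ γ := (norm_nonneg _).trans (hγ x ⟨0, hd⟩)
  have hr0 : 0 ≤ r := (norm_nonneg _).trans (hr x ⟨0, hd⟩)
  have hwU : IsUnitarySite w := expGauge_unitary hlams hw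
  have hσ : ∀ y, ‖(w y : Matrix n n ℂ) - 1‖ ≤ 2 * Λ := norm_expGauge_sub_one_le hw hΛ (by linarith)
  -- transported gauges: `w̃(y,μ) := W(y,μ)⁻¹ w(y) W(y,μ) = e^{Ad_{W⁻¹} λ(y)}`, `v₊ := W w(y+e_μ) W⁻¹ = e^{Ad_W λ(y+e_μ)}`
  have hwt : ∀ (y : Site d) (μ : Fin d), (((W y μ)⁻¹ * w y * W y μ : (Matrix n n ℂ)ˣ) : Matrix n n ℂ) = exp (Ad (W y μ)⁻¹ (lam y)) := by
    intro y μ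
    rw [Units.val_mul, Units.val_mul, hw y]
    unfold Ad; rw [inv_inv]; exact (exp_units_conj' (W y μ) (lam y)).symm
  have hvp : ∀ (y : Site d) (μ : Fin d), ((W y μ * w (y + e μ) * (W y μ)⁻¹ : (Matrix n n ℂ)ˣ) : Matrix n n ℂ) = exp (Ad (W y μ) (lam (y + e μ))) := by
    intro y μ
    rw [Units.val_mul, Units.val_mul, hw (y + e μ)]
    unfold Ad; exact (exp_units_conj (W y μ) (lam (y + e μ))).symm
  have hAdn : ∀ (u : (Matrix n n ℂ)ˣ) (y : Site d), u ∈ unitaryUnits (Matrix n n ℂ) → ‖Ad u (lam y)‖ ≤ Λ := fun u y hu => by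
    rw [norm_Ad_of_unitary hu]; exact hΛ y
  -- the covariant oscillations of the gauge
  have hγfw : ∀ (y : Site d) (μ : Fin d), ‖(((W y μ)⁻¹ * w y * W y μ : (Matrix n n ℂ)ˣ) : Matrix n n ℂ) - w (y + e μ)‖ ≤ 5 / 4 * γ := by
    intro y μ
    rw [hwt, hw]
    refine (norm_exp_sub_exp_le' (hAdn _ _ ((unitaryUnits _).inv_mem (hWu y μ))) (hΛ _) hΛ1).trans ?_
    have : Ad (W y μ)⁻¹ (lam y) - lam (y + e μ) = gaugeDir W lam y μ := rfl
    rw [this]; linarith [hγ y μ]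
  have hγbw : ∀ (y : Site d) (μ : Fin d), ‖(w y : Matrix n n ℂ) - (((W (y - e μ) μ)⁻¹ * w (y - e μ) * W (y - e μ) μ : (Matrix n n ℂ)ˣ) : Matrix n n ℂ)‖
      ≤ 5 / 4 * γ := by
    intro y μ
    rw [norm_sub_rev]
    have h := hγfw (y - e μ) μ
    rwa [sub_add_cancel] at h
  have hZn : ∀ (y : Site d) (μ : Fin d), ‖mlog (((W y μ)⁻¹ * V y μ : (Matrix n n ℂ)ˣ) : Matrix n n ℂ)‖ ≤ 2 * r := fun y μ =>
    (norm_mlog_le_two_mul ((hr y μ).trans (by linarith))).trans (by linarith [hr y μ])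
  set Z : Site d → Fin d → Matrix n n ℂ := fun y μ => mlog (((W y μ)⁻¹ * V y μ : (Matrix n n ℂ)ˣ) : Matrix n n ℂ) with hZ_def
  -- the bond identity `W⁻¹ V^{w} = w̃ · (W⁻¹V) · w′⁻¹` and the bond junk
  have hbond : ∀ (y : Site d) (μ : Fin d), (W y μ)⁻¹ * gaugeAct w V y μ = ((W y μ)⁻¹ * w y * W y μ) * ((W y μ)⁻¹ * V y μ) * (w (y + e μ))⁻¹ := by
    intro y μ; simp only [gaugeAct]; group
  set B : Site d → Fin d → Matrix n n ℂ := fun y μ =>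
    mlog (((W y μ)⁻¹ * gaugeAct w V y μ : (Matrix n n ℂ)ˣ) : Matrix n n ℂ) - Ad ((W y μ)⁻¹ * w y * W y μ) (Z y μ)
      - mlog ((((W y μ)⁻¹ * w y * W y μ) * (w (y + e μ))⁻¹ : (Matrix n n ℂ)ˣ) : Matrix n n ℂ) with hB_def
  have htU : ∀ (y : Site d) (μ : Fin d), ((W y μ)⁻¹ * w y * W y μ : (Matrix n n ℂ)ˣ) ∈ unitaryUnits (Matrix n n ℂ) := fun y μ =>
    (unitaryUnits _).mul_mem ((unitaryUnits _).mul_mem ((unitaryUnits _).inv_mem (hWu _ _)) (hwU _)) (hWu _ _)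
  have hB : ∀ (y : Site d) (μ : Fin d), ‖B y μ‖ ≤ 8 * r * (5 / 4 * γ) := by
    intro y μ
    have h := norm_mlog_gaugeBond_sub_le (V := (W y μ)⁻¹ * V y μ) (htU y μ) (hwU (y + e μ)) (hr y μ) hr1 (hγfw y μ) (by linarith)
    simp only [hB_def, hZ_def, hbond y μ]
    exact h
  have hpt : ∀ (y : Site d) (μ : Fin d), mlog (((W y μ)⁻¹ * gaugeAct w V y μ : (Matrix n n ℂ)ˣ) : Matrix n n ℂ)
      = Ad ((W y μ)⁻¹ * w y * W y μ) (Z y μ) + mlog ((((W y μ)⁻¹ * w y * W y μ) * (w (y + e μ))⁻¹ : (Matrix n n ℂ)ˣ) : Matrix n n ℂ) + B y μ :=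
    fun y μ => by simp only [hB_def]; abel
  -- the pure gauges, forward: `Ad_W log(w̃ w′⁻¹) = log(w(x) v₊⁻¹)`; backward: `log(w̃(x−e_μ) w(x)⁻¹) = −log(w(x) w̃(x−e_μ)⁻¹)`
  have hfw : ∀ μ : Fin d, Ad (W x μ) (mlog ((((W x μ)⁻¹ * w x * W x μ) * (w (x + e μ))⁻¹ : (Matrix n n ℂ)ˣ) : Matrix n n ℂ))
      = mlog ((w x * (W x μ * w (x + e μ) * (W x μ)⁻¹)⁻¹ : (Matrix n n ℂ)ˣ) : Matrix n n ℂ) := by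
    intro μ
    have h1 : ‖((((W x μ)⁻¹ * w x * W x μ) * (w (x + e μ))⁻¹ : (Matrix n n ℂ)ˣ) : Matrix n n ℂ) - 1‖ < 1 :=
      ((norm_pureGauge_sub_one_le (hwU _)).trans (hγfw x μ)).trans_lt (by linarith)
    have h2 : W x μ * (((W x μ)⁻¹ * w x * W x μ) * (w (x + e μ))⁻¹) * (W x μ)⁻¹ = w x * (W x μ * w (x + e μ) * (W x μ)⁻¹)⁻¹ := by group
    unfold Ad
    rw [← mlog_units_conj (mem_U1_of_unitary (hWu x μ)) h1, ← Units.val_mul, ← Units.val_mul, h2]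
  have hbw : ∀ μ : Fin d, mlog ((((W (x - e μ) μ)⁻¹ * w (x - e μ) * W (x - e μ) μ) * (w (x - e μ + e μ))⁻¹ : (Matrix n n ℂ)ˣ) : Matrix n n ℂ)
      = -mlog ((w x * ((W (x - e μ) μ)⁻¹ * w (x - e μ) * W (x - e μ) μ)⁻¹ : (Matrix n n ℂ)ˣ) : Matrix n n ℂ) := by
    intro μ
    have hw' : ((w x * ((W (x - e μ) μ)⁻¹ * w (x - e μ) * W (x - e μ) μ)⁻¹)⁻¹ : (Matrix n n ℂ)ˣ)
        = ((W (x - e μ) μ)⁻¹ * w (x - e μ) * W (x - e μ) μ) * (w (x - e μ + e μ))⁻¹ := by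
      rw [mul_inv_rev, inv_inv, sub_add_cancel]
    have h1 : ‖((w x * ((W (x - e μ) μ)⁻¹ * w (x - e μ) * W (x - e μ) μ)⁻¹ : (Matrix n n ℂ)ˣ) : Matrix n n ℂ) - 1‖ ≤ 1 / 4 :=
      ((norm_pureGauge_sub_one_le (htU _ _)).trans (hγbw x μ)).trans (by linarith)
    rw [← hw', mlog_inv_unit h1]
  -- the splitting
  have hZ' : covDiv W (fun y μ => mlog (((W y μ)⁻¹ * gaugeAct w V y μ : (Matrix n n ℂ)ˣ) : Matrix n n ℂ)) x
      = ∑ μ : Fin d, (Ad (W x μ) (Ad ((W x μ)⁻¹ * w x * W x μ) (Z x μ)) - Ad ((W (x - e μ) μ)⁻¹ * w (x - e μ) * W (x - e μ) μ) (Z (x - e μ) μ))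
        + ∑ μ : Fin d, (mlog ((w x * (W x μ * w (x + e μ) * (W x μ)⁻¹)⁻¹ : (Matrix n n ℂ)ˣ) : Matrix n n ℂ)
            + mlog ((w x * ((W (x - e μ) μ)⁻¹ * w (x - e μ) * W (x - e μ) μ)⁻¹ : (Matrix n n ℂ)ˣ) : Matrix n n ℂ))
        + ∑ μ : Fin d, (Ad (W x μ) (B x μ) - B (x - e μ) μ) := by
    rw [← Finset.sum_add_distrib, ← Finset.sum_add_distrib]
    simp only [covDiv]
    refine Finset.sum_congr rfl fun μ _ => ?_
    rw [hpt x μ, hpt (x - e μ) μ, hbw μ, AveragingDeficitNearIdentity.Ad_add, AveragingDeficitNearIdentity.Ad_add, hfw μ]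
    abel
  have hsplit : covDiv W (fun y μ => mlog (((W y μ)⁻¹ * gaugeAct w V y μ : (Matrix n n ℂ)ˣ) : Matrix n n ℂ)) x - covDiv W Z x - covLapSite W lam x
      = (∑ μ : Fin d, (Ad (W x μ) (Ad ((W x μ)⁻¹ * w x * W x μ) (Z x μ)) - Ad ((W (x - e μ) μ)⁻¹ * w (x - e μ) * W (x - e μ) μ) (Z (x - e μ) μ))
          - covDiv W Z x)
        + (∑ μ : Fin d, (mlog ((w x * (W x μ * w (x + e μ) * (W x μ)⁻¹)⁻¹ : (Matrix n n ℂ)ˣ) : Matrix n n ℂ)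
            + mlog ((w x * ((W (x - e μ) μ)⁻¹ * w (x - e μ) * W (x - e μ) μ)⁻¹ : (Matrix n n ℂ)ˣ) : Matrix n n ℂ)) - covLapSite W lam x)
        + ∑ μ : Fin d, (Ad (W x μ) (B x μ) - B (x - e μ) μ) := by
    rw [hZ']; abel
  rw [hsplit]
  -- T1
  have hT1 := norm_sum_Ad_sub_covDiv_W_le hwU hWu hσ hγbw hZn x
  -- T2 by the abstract pure-gauge lemma over `Fin d ⊕ Fin d`
  have hT2 : ‖∑ μ : Fin d, (mlog ((w x * (W x μ * w (x + e μ) * (W x μ)⁻¹)⁻¹ : (Matrix n n ℂ)ˣ) : Matrix n n ℂ)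
        + mlog ((w x * ((W (x - e μ) μ)⁻¹ * w (x - e μ) * W (x - e μ) μ)⁻¹ : (Matrix n n ℂ)ˣ) : Matrix n n ℂ)) - covLapSite W lam x‖
      ≤ 4 * Λ * ‖covLapSite W lam x‖ + 14 * d * γ ^ 2 := by
    set ν : Fin d ⊕ Fin d → Matrix n n ℂ := Sum.elim (fun μ => Ad (W x μ) (lam (x + e μ))) (fun μ => Ad (W (x - e μ) μ)⁻¹ (lam (x - e μ))) with hν
    have hνs : ∀ i ∈ (Finset.univ : Finset (Fin d ⊕ Fin d)), ν i ∈ skewAdjoint (Matrix n n ℂ) := by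
      rintro (μ | μ) -
      · exact AveragingDeficitTransport.Ad_mem_skewAdjoint (hWu x μ) (hlams _)
      · exact AveragingDeficitTransport.Ad_mem_skewAdjoint ((unitaryUnits _).inv_mem (hWu _ _)) (hlams _)
    have hνn : ∀ i ∈ (Finset.univ : Finset (Fin d ⊕ Fin d)), ‖ν i‖ ≤ Λ := by
      rintro (μ | μ) -
      · exact hAdn _ _ (hWu x μ)
      · exact hAdn _ _ ((unitaryUnits _).inv_mem (hWu _ _))
    have hνγ : ∀ i ∈ (Finset.univ : Finset (Fin d ⊕ Fin d)), ‖lam x - ν i‖ ≤ γ := by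
      rintro (μ | μ) -
      · rw [hν, Sum.elim_inl]
        have h : lam x - Ad (W x μ) (lam (x + e μ)) = Ad (W x μ) (gaugeDir W lam x μ) := by
          unfold gaugeDir
          rw [show Ad (W x μ)⁻¹ (lam x) - lam (x + e μ) = Ad (W x μ)⁻¹ (lam x) + (-lam (x + e μ)) by abel,
            AveragingDeficitNearIdentity.Ad_add, Ad_Ad_inv', AveragingDeficitNearIdentity.Ad_neg]; abel
        rw [h, norm_Ad_of_unitary (hWu x μ)]; exact hγ x μ
      · rw [hν, Sum.elim_inr]
        have h : lam x - Ad (W (x - e μ) μ)⁻¹ (lam (x - e μ)) = -gaugeDir W lam (x - e μ) μ := by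
          unfold gaugeDir; rw [sub_add_cancel]; abel
        rw [h, norm_neg]; exact hγ _ _
    have hab := norm_sum_mlog_pureGauge_abstract_le (Finset.univ : Finset (Fin d ⊕ Fin d)) (hlams x) hνs (hΛ x) hνn hΛ1 hνγ hγ0 hγ1
    -- identify the two sums
    have hinvp : ∀ μ : Fin d, (((W x μ * w (x + e μ) * (W x μ)⁻¹)⁻¹ : (Matrix n n ℂ)ˣ) : Matrix n n ℂ) = exp (-ν (Sum.inl μ)) := fun μ => by
      rw [hν, Sum.elim_inl]; exact units_val_inv_eq_exp_neg (hvp x μ)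
    have hinvm : ∀ μ : Fin d, ((((W (x - e μ) μ)⁻¹ * w (x - e μ) * W (x - e μ) μ)⁻¹ : (Matrix n n ℂ)ˣ) : Matrix n n ℂ) = exp (-ν (Sum.inr μ)) :=
      fun μ => by rw [hν, Sum.elim_inr]; exact units_val_inv_eq_exp_neg (hwt (x - e μ) μ)
    have hS1 : ∑ i ∈ (Finset.univ : Finset (Fin d ⊕ Fin d)), mlog (exp (lam x) * exp (-ν i))
        = ∑ μ : Fin d, (mlog ((w x * (W x μ * w (x + e μ) * (W x μ)⁻¹)⁻¹ : (Matrix n n ℂ)ˣ) : Matrix n n ℂ)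
          + mlog ((w x * ((W (x - e μ) μ)⁻¹ * w (x - e μ) * W (x - e μ) μ)⁻¹ : (Matrix n n ℂ)ˣ) : Matrix n n ℂ)) := by
      rw [Fintype.sum_sum_type, ← Finset.sum_add_distrib]
      refine Finset.sum_congr rfl fun μ _ => ?_
      rw [Units.val_mul, Units.val_mul, hinvp, hinvm, hw x]
    have hS2 : ∑ i ∈ (Finset.univ : Finset (Fin d ⊕ Fin d)), (lam x - ν i) = covLapSite W lam x := by
      rw [Fintype.sum_sum_type, covLapSite_eq_sum_neighbours, ← Finset.sum_add_distrib]
      rfl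
    rw [hS1, hS2] at hab
    refine hab.trans ?_
    have hcard : ((Finset.univ : Finset (Fin d ⊕ Fin d)).card : ℝ) = 2 * d := by
      rw [Finset.card_univ, Fintype.card_sum, Fintype.card_fin]; push_cast; ring
    rw [hcard]; nlinarith [sq_nonneg γ]
  -- T3
  have hT3 : ‖∑ μ : Fin d, (Ad (W x μ) (B x μ) - B (x - e μ) μ)‖ ≤ d * (2 * (8 * r * (5 / 4 * γ))) := by
    calc _ ≤ ∑ _μ : Fin d, (8 * r * (5 / 4 * γ) + 8 * r * (5 / 4 * γ)) :=
          (norm_sum_le _ _).trans (Finset.sum_le_sum fun μ _ => (norm_sub_le _ _).trans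
            (add_le_add (by rw [norm_Ad_of_unitary (hWu x μ)]; exact hB _ _) (hB _ _)))
      _ = d * (2 * (8 * r * (5 / 4 * γ))) := by simp; ring
  calc _ ≤ ‖∑ μ : Fin d, (Ad (W x μ) (Ad ((W x μ)⁻¹ * w x * W x μ) (Z x μ)) - Ad ((W (x - e μ) μ)⁻¹ * w (x - e μ) * W (x - e μ) μ) (Z (x - e μ) μ))
          - covDiv W Z x‖
        + ‖∑ μ : Fin d, (mlog ((w x * (W x μ * w (x + e μ) * (W x μ)⁻¹)⁻¹ : (Matrix n n ℂ)ˣ) : Matrix n n ℂ)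
            + mlog ((w x * ((W (x - e μ) μ)⁻¹ * w (x - e μ) * W (x - e μ) μ)⁻¹ : (Matrix n n ℂ)ˣ) : Matrix n n ℂ)) - covLapSite W lam x‖
        + ‖∑ μ : Fin d, (Ad (W x μ) (B x μ) - B (x - e μ) μ)‖ := norm_add₃_le
    _ ≤ (2 * (2 * Λ) * ‖covDiv W Z x‖ + 2 * d * (5 / 4 * γ) * (2 * r)) + (4 * Λ * ‖covLapSite W lam x‖ + 14 * d * γ ^ 2)
        + d * (2 * (8 * r * (5 / 4 * γ))) := add_le_add (add_le_add hT1 hT2) hT3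
    _ = 4 * Λ * (‖covDiv W Z x‖ + ‖covLapSite W lam x‖) + 25 * d * r * γ + 14 * d * γ ^ 2 := by ring

/-- **THE NEW RELATIVE RADIUS AND POTENTIAL**: under the hypotheses of `norm_covDiv_mlog_gaugeAct_sub_le_W`, `‖W(b)⁻¹V^{w}(b) − 1‖ ≤ r + (5∕4)γ`,
`‖log W⁻¹V^{w}(b)‖ ≤ 2(r + (5∕4)γ)`, the new relative potential is skew, and `W⁻¹V^{w}` is unitary bondwise. [folklore] -/
theorem gaugeAct_letters_W {W V : Site d → Fin d → (Matrix n n ℂ)ˣ} (hWu : IsUnitaryCfg W) (hV : IsUnitaryCfg V) {r : ℝ}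
    (hr : ∀ (y : Site d) (μ : Fin d), ‖(((W y μ)⁻¹ * V y μ : (Matrix n n ℂ)ˣ) : Matrix n n ℂ) - 1‖ ≤ r) (hr1 : r ≤ 1 / 20)
    {lam : Site d → Matrix n n ℂ} (hlams : ∀ y, lam y ∈ skewAdjoint (Matrix n n ℂ)) {Λ γ : ℝ}
    (hΛ : ∀ y, ‖lam y‖ ≤ Λ) (hΛ1 : Λ ≤ 1 / 10) (hγ : ∀ (y : Site d) (μ : Fin d), ‖gaugeDir W lam y μ‖ ≤ γ) (hγ1 : γ ≤ 1 / 25)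
    {w : Site d → (Matrix n n ℂ)ˣ} (hw : ∀ y, (w y : Matrix n n ℂ) = exp (lam y)) (y : Site d) (μ : Fin d) :
    ‖(((W y μ)⁻¹ * gaugeAct w V y μ : (Matrix n n ℂ)ˣ) : Matrix n n ℂ) - 1‖ ≤ r + 5 / 4 * γ ∧
      ‖mlog (((W y μ)⁻¹ * gaugeAct w V y μ : (Matrix n n ℂ)ˣ) : Matrix n n ℂ)‖ ≤ 2 * (r + 5 / 4 * γ) ∧
      mlog (((W y μ)⁻¹ * gaugeAct w V y μ : (Matrix n n ℂ)ˣ) : Matrix n n ℂ) ∈ skewAdjoint (Matrix n n ℂ) ∧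
      ((W y μ)⁻¹ * gaugeAct w V y μ : (Matrix n n ℂ)ˣ) ∈ unitaryUnits (Matrix n n ℂ) := by
  letI : NormedAlgebra ℚ (Matrix n n ℂ) := NormedAlgebra.restrictScalars ℚ ℝ (Matrix n n ℂ)
  have hwU : IsUnitarySite w := expGauge_unitary hlams hw
  have hwt : (((W y μ)⁻¹ * w y * W y μ : (Matrix n n ℂ)ˣ) : Matrix n n ℂ) = exp (Ad (W y μ)⁻¹ (lam y)) := by
    rw [Units.val_mul, Units.val_mul, hw y]
    unfold Ad; rw [inv_inv]; exact (exp_units_conj' (W y μ) (lam y)).symm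
  have hγu : ‖(((W y μ)⁻¹ * w y * W y μ : (Matrix n n ℂ)ˣ) : Matrix n n ℂ) - w (y + e μ)‖ ≤ 5 / 4 * γ := by
    rw [hwt, hw]
    refine (norm_exp_sub_exp_le' (by rw [norm_Ad_of_unitary ((unitaryUnits _).inv_mem (hWu y μ))]; exact hΛ y) (hΛ _) hΛ1).trans ?_
    have : Ad (W y μ)⁻¹ (lam y) - lam (y + e μ) = gaugeDir W lam y μ := rfl
    rw [this]; linarith [hγ y μ]
  have htU : ((W y μ)⁻¹ * w y * W y μ : (Matrix n n ℂ)ˣ) ∈ unitaryUnits (Matrix n n ℂ) :=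
    (unitaryUnits _).mul_mem ((unitaryUnits _).mul_mem ((unitaryUnits _).inv_mem (hWu _ _)) (hwU _)) (hWu _ _)
  have hRU : ((W y μ)⁻¹ * V y μ : (Matrix n n ℂ)ˣ) ∈ unitaryUnits (Matrix n n ℂ) :=
    (unitaryUnits _).mul_mem ((unitaryUnits _).inv_mem (hWu _ _)) (hV _ _)
  have hbond : (W y μ)⁻¹ * gaugeAct w V y μ = ((W y μ)⁻¹ * w y * W y μ) * ((W y μ)⁻¹ * V y μ) * (w (y + e μ))⁻¹ := by
    simp only [gaugeAct]; group
  have hunit : ((W y μ)⁻¹ * gaugeAct w V y μ : (Matrix n n ℂ)ˣ) ∈ unitaryUnits (Matrix n n ℂ) := by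
    rw [hbond]; exact (unitaryUnits _).mul_mem ((unitaryUnits _).mul_mem htU hRU) ((unitaryUnits _).inv_mem (hwU _))
  have h1 : ‖(((W y μ)⁻¹ * gaugeAct w V y μ : (Matrix n n ℂ)ˣ) : Matrix n n ℂ) - 1‖ ≤ r + 5 / 4 * γ := by
    rw [hbond]; exact (norm_gaugeBond_sub_one_le hRU htU (hwU _)).trans (add_le_add (hr y μ) hγu)
  have h14 : ‖(((W y μ)⁻¹ * gaugeAct w V y μ : (Matrix n n ℂ)ˣ) : Matrix n n ℂ) - 1‖ ≤ 1 / 4 := h1.trans (by linarith)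
  exact ⟨h1, (norm_mlog_le_two_mul (h14.trans (by norm_num))).trans (by linarith), mlog_mem_skewAdjoint_of_unitary hunit h14, hunit⟩

end Divergence

end

end Summit.QuantumFields.BalabanUV.T4Continuum.NE3.CurvedLandauGaugeStep
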